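import Literature.Barriers.Parity.SiegelZeroDichotomyPairHLSieveLocal
import HarnessLib

/-!
# Tao–Teräväinen 2022, Lemma 3.4 at `k = 2`, `ℓ' = 0`: integration and the weighted form

Topic `Literature/Barriers/Parity`, sub-namespace `TaoTeravainen`; last file of the proof of
Tao–Teräväinen's Lemma 3.4 (arXiv:2109.06291, §3.2) at `k = 2`, after `…SieveExpansion.lean`
(`S = xΣ + O(R⁴)`), `…SieveFourier.lean` (`Σ = ∑_Y (-1)^{|Y|}∫_{ℝ⁴} K_Y W_Y`), `…SieveEuler.lean`
(`K_Y` as an Euler product) and `…SieveLocal.lean` (`‖K_Y(τ)‖ ≤ C_K σ_τ^{216}/log² R · gainWeight`).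
Everything here is PROVED; the result is the input "Lemma 3.4" of the proofs of (5.7) and (5.8)
(`TaoTeravainen2021_eq57_pair`, `_eq58_pair` of `SiegelZeroDichotomyPairHLStepTwo.lean`).

Lemma 3.4 (Selberg sieve concentrates on almost primes), `k = 2`, `ℓ' = 0`: "let `1 ≤ d₁, d₂ ≤ x` be
integers. Then `𝔼_{n ≤ x} ∏_{j=1}^2 ν(n+h_j) 1_{d_j∣n+h_j} ≪_A τ(d₁d₂)^{O(1)}/(d₁d₂ log² R)
∫₁^∞ (∏_{p∣d₁d₂} min(σ log_R p,1)) dσ/σ^A + R⁴/x` for any `A > 0`." The source integrates the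
pointwise bound against the Schwartz weights `∏ f(t_j)` ("using the rapid decay of `f` and the
triangle inequality") and keeps `σ = 1 + ∑|t_j|` as a variable of integration; in its two
applications ((5.7), (5.8)) the bound is then summed over the moduli with weights, the resulting
Euler products are bounded by `σ^{O(1)} × (gain)` pointwise in `σ`, and "choosing `A` large enough"
closes. Here the order of these two steps is exchanged once and for all: the weighted family is
summed under the integral and the `σ`-integral is evaluated at the end
(`sieveCorrelation_weighted_le`). [cite: TaoTeravainen2021, Lemma 3.4 and its proof; §5 (proofs of (5.7), (5.8))]

* `fourierMajorant = ‖f‖ + 1_{[0,1]}`, `tauMajorant = G`, `momentConst ψ n = J_n = ∫ (1+|t|)ⁿ g`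
  (finite: `integrable_pow_mul_fourierMajorant`, from the tree's decay of `cutoffFourier`);
* `integrable_tauSize_pow_mul` — `∫_{ℝ⁴} σ_τⁿ G(τ) dτ ≤ J_n⁴` (`σ_τ ≤ ∏(1+|τ_k|)`, Fubini);
* `kernelMajorant = b_d`, `abs_sieveMainSum_le_integral` — `|Σ(d)| ≤ 16 ∫ b_d G`;
* **`sieveCorrelation_weighted_le`** — for weights `a_d ≥ 0` on finitely many pairs of moduli with
  `∑_d a_d gainWeight(R; d; σ) ≤ M σ^N` for all `σ ≥ 1`:
  `∑_d a_d S(d) ≤ x · 16 C_K M J_{216+N}⁴/log² R + (B⌈R⌉)⁴ ∑_d a_d`.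
-/

noncomputable section

open Finset MeasureTheory
open scoped ArithmeticFunction.Moebius

namespace Literature.Barriers.Parity

namespace TaoTeravainen

/-! ### The majorant of the padded weights and its moments -/

/-- `g(t) = ‖f(t)‖ + 1_{[0,1]}(t)`, a common majorant of the two kinds of slot factor. [folklore] -/
def fourierMajorant (ψ : ℝ → ℝ) (t : ℝ) : ℝ :=
  ‖cutoffFourier ψ 1 t‖ + padFn t

/-- `g ≥ 0`. [folklore] -/
theorem fourierMajorant_nonneg (ψ : ℝ → ℝ) (t : ℝ) : 0 ≤ fourierMajorant ψ t :=
  add_nonneg (norm_nonneg _) (padFn_nonneg t)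

/-- `G(τ) = ∏_k g(τ_k)`. [folklore] -/
def tauMajorant (ψ : ℝ → ℝ) (τ : Fin 4 → ℝ) : ℝ :=
  ∏ k, fourierMajorant ψ (τ k)

/-- `G ≥ 0`. [folklore] -/
theorem tauMajorant_nonneg (ψ : ℝ → ℝ) (τ : Fin 4 → ℝ) : 0 ≤ tauMajorant ψ τ :=
  Finset.prod_nonneg fun k _ => fourierMajorant_nonneg ψ (τ k)

/-- The moments `J_n = ∫ (1+|t|)ⁿ g(t) dt` (finite for every `n` by the decay of `f` to all
orders, `cutoffFourier_decay`; this is "the rapid decay of `f`" of the source). [cite: TaoTeravainen2021, §3.2 (proof of Lemma 3.4: "using the rapid decay of `f`")] -/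
def momentConst (ψ : ℝ → ℝ) (n : ℕ) : ℝ :=
  ∫ t, (1 + |t|) ^ n * fourierMajorant ψ t

/-- `‖W_Y(τ)‖ ≤ G(τ)`. [folklore] -/
theorem norm_padWeight_le (ψ : ℝ → ℝ) (Y : Finset (Fin 4)) (τ : Fin 4 → ℝ) :
    ‖padWeight ψ Y τ‖ ≤ tauMajorant ψ τ := by
  unfold padWeight tauMajorant
  rw [norm_prod]
  refine Finset.prod_le_prod (fun k _ => norm_nonneg _) fun k _ => ?_
  unfold fourierMajorant
  split_ifs
  · linarith [padFn_nonneg (τ k)]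
  · rw [Complex.norm_real, Real.norm_eq_abs, abs_of_nonneg (padFn_nonneg _)]
    linarith [norm_nonneg (cutoffFourier ψ 1 (τ k))]

/-- Measurability of `padFn`. [folklore] -/
theorem measurable_padFn : Measurable padFn := by
  unfold padFn
  exact measurable_const.indicator measurableSet_Icc

/-- Measurability of `g`. [folklore] -/
theorem measurable_fourierMajorant {ψ : ℝ → ℝ} (hψ : IsSmoothCutoff ψ) : Measurable (fourierMajorant ψ) :=
  ((hψ.continuous_cutoffFourier one_pos le_rfl).norm.measurable).add measurable_padFn

/-- Measurability of `G`. [folklore] -/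
theorem measurable_tauMajorant {ψ : ℝ → ℝ} (hψ : IsSmoothCutoff ψ) : Measurable (tauMajorant ψ) := by
  unfold tauMajorant
  refine Finset.measurable_prod _ fun k _ => ?_
  exact (measurable_fourierMajorant hψ).comp (measurable_pi_apply k)

/-- `(1+|t|)ⁿ g(t)` is integrable (decay of `f` to all orders; `1_{[0,1]}` has compact support).
[cite: TaoTeravainen2021, §3.2 (3.17) and (6.10): "`f(t) ≪_A (1+|t|)^{-A}`"] -/
theorem integrable_pow_mul_fourierMajorant {ψ : ℝ → ℝ} (hψ : IsSmoothCutoff ψ) (n : ℕ) :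
    Integrable fun t : ℝ => (1 + |t|) ^ n * fourierMajorant ψ t := by
  have h1 : Integrable fun t : ℝ => (1 + |t|) ^ n * ‖cutoffFourier ψ 1 t‖ :=
    hψ.integrable_pow_mul_norm_cutoffFourier n one_pos le_rfl
  have h2 : Integrable fun t : ℝ => (1 + |t|) ^ n * padFn t := by
    have hmeas : AEStronglyMeasurable (fun t : ℝ => (1 + |t|) ^ n * padFn t) volume :=
      ((continuous_const.add continuous_abs).pow n).aestronglyMeasurable.mul
        measurable_padFn.aestronglyMeasurable
    refine Integrable.mono' (integrable_padFn.const_mul ((2 : ℝ) ^ n)) hmeas ?_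
    filter_upwards with t
    rw [Real.norm_eq_abs, abs_of_nonneg (mul_nonneg (by positivity) (padFn_nonneg t))]
    unfold padFn
    by_cases ht : t ∈ Set.Icc (0 : ℝ) 1
    · rw [Set.indicator_of_mem ht]
      have : 1 + |t| ≤ 2 := by
        rw [abs_of_nonneg ht.1]
        linarith [ht.2]
      have h0 : 0 ≤ 1 + |t| := by positivity
      have := pow_le_pow_left₀ h0 this n
      nlinarith
    · rw [Set.indicator_of_notMem ht]
      simp
  have := h1.add h2
  refine this.congr (Filter.Eventually.of_forall fun t => ?_)
  simp only [fourierMajorant, Pi.add_apply]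
  ring

/-- `J_n ≥ 0`. [folklore] -/
theorem momentConst_nonneg (ψ : ℝ → ℝ) (n : ℕ) : 0 ≤ momentConst ψ n :=
  integral_nonneg fun t => mul_nonneg (by positivity) (fourierMajorant_nonneg ψ t)

/-! ### Integrability on `ℝ⁴` and the bound `∫ σ_τⁿ G(τ) dτ ≤ J_n⁴` -/

/-- `σ_τ = 1 + ∑|τ_k| ≤ ∏_k (1 + |τ_k|)`. [folklore] -/
theorem tauSize_le_prod (τ : Fin 4 → ℝ) : tauSize τ ≤ ∏ k, (1 + |τ k|) := by
  unfold tauSize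
  rw [Fin.sum_univ_four, Fin.prod_univ_four]
  have h0 := abs_nonneg (τ 0)
  have h1 := abs_nonneg (τ 1)
  have h2 := abs_nonneg (τ 2)
  have h3 := abs_nonneg (τ 3)
  nlinarith [mul_nonneg h0 h1, mul_nonneg h2 h3, mul_nonneg (mul_nonneg h0 h1) (mul_nonneg h2 h3),
    mul_nonneg h0 h2, mul_nonneg h0 h3, mul_nonneg h1 h2, mul_nonneg h1 h3,
    mul_nonneg (mul_nonneg h0 h1) h2, mul_nonneg (mul_nonneg h0 h1) h3,
    mul_nonneg (mul_nonneg h0 h2) h3, mul_nonneg (mul_nonneg h1 h2) h3]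

/-- Continuity of `σ_τ`. [folklore] -/
theorem continuous_tauSize : Continuous tauSize := by
  unfold tauSize
  exact continuous_const.add (continuous_finsetSum _ fun k _ => (continuous_apply k).abs)

/-- **`σ_τⁿ G(τ)` is integrable on `ℝ⁴` and `∫ σ_τⁿ G(τ) dτ ≤ J_n⁴`** (dominate by
`∏_k (1+|τ_k|)ⁿ g(τ_k)` and use Fubini). [cite: TaoTeravainen2021, §3.2 (proof of Lemma 3.4: "using the rapid decay of `f` and the triangle inequality")] -/
theorem integrable_tauSize_pow_mul {ψ : ℝ → ℝ} (hψ : IsSmoothCutoff ψ) (n : ℕ) :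
    Integrable (fun τ : Fin 4 → ℝ => tauSize τ ^ n * tauMajorant ψ τ) ∧
      ∫ τ : Fin 4 → ℝ, tauSize τ ^ n * tauMajorant ψ τ ≤ momentConst ψ n ^ 4 := by
  set φ : ℝ → ℝ := fun t => (1 + |t|) ^ n * fourierMajorant ψ t with hφ
  have hφint : Integrable φ := integrable_pow_mul_fourierMajorant hψ n
  have hprod : Integrable (fun τ : Fin 4 → ℝ => ∏ k, φ (τ k))
      (Measure.pi fun _ : Fin 4 => (volume : Measure ℝ)) :=
    Integrable.fintype_prod fun _ => hφint
  rw [← volume_pi] at hprod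
  have hle : ∀ τ : Fin 4 → ℝ, tauSize τ ^ n * tauMajorant ψ τ ≤ ∏ k, φ (τ k) := by
    intro τ
    have h1 : tauSize τ ^ n ≤ (∏ k, (1 + |τ k|)) ^ n :=
      pow_le_pow_left₀ (by linarith [one_le_tauSize τ]) (tauSize_le_prod τ) n
    rw [← Finset.prod_pow] at h1
    calc tauSize τ ^ n * tauMajorant ψ τ ≤ (∏ k, (1 + |τ k|) ^ n) * tauMajorant ψ τ :=
          mul_le_mul_of_nonneg_right h1 (tauMajorant_nonneg ψ τ)
      _ = ∏ k, φ (τ k) := by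
          unfold tauMajorant
          rw [← Finset.prod_mul_distrib]
  have hnn : ∀ τ : Fin 4 → ℝ, 0 ≤ tauSize τ ^ n * tauMajorant ψ τ := fun τ =>
    mul_nonneg (pow_nonneg (by linarith [one_le_tauSize τ]) n) (tauMajorant_nonneg ψ τ)
  have hmeas : AEStronglyMeasurable (fun τ : Fin 4 → ℝ => tauSize τ ^ n * tauMajorant ψ τ) volume :=
    ((continuous_tauSize.pow n).aestronglyMeasurable).mul (measurable_tauMajorant hψ).aestronglyMeasurable
  have hint : Integrable (fun τ : Fin 4 → ℝ => tauSize τ ^ n * tauMajorant ψ τ) := by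
    refine Integrable.mono' hprod hmeas ?_
    filter_upwards with τ
    rw [Real.norm_eq_abs, abs_of_nonneg (hnn τ)]
    exact hle τ
  refine ⟨hint, ?_⟩
  calc ∫ τ : Fin 4 → ℝ, tauSize τ ^ n * tauMajorant ψ τ ≤ ∫ τ : Fin 4 → ℝ, ∏ k, φ (τ k) :=
        integral_mono hint hprod hle
    _ = ∏ _k : Fin 4, ∫ t, φ t := integral_fintype_prod_volume_eq_prod (fun _ => φ)
    _ = momentConst ψ n ^ 4 := by
        rw [Finset.prod_const, Finset.card_univ, Fintype.card_fin]
        rfl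

/-! ### The main term bounded by an integral against `G` -/

/-- Continuity of `σ ↦ gainWeight R d σ`. [folklore] -/
theorem continuous_gainWeight (R : ℝ) (d : Fin 2 → ℕ) : Continuous fun σ : ℝ => gainWeight R d σ := by
  unfold gainWeight gainMin
  refine continuous_const.mul (continuous_finsetProd _ fun p _ => ?_)
  exact (((continuous_id.mul continuous_const).div_const _).min continuous_const)

/-- `gainWeight ≤ 1944^{ω}/(d₀d₁)` (all gains are `≤ 1`). [folklore] -/
theorem gainWeight_le {R : ℝ} (hR : 1 < R) (d : Fin 2 → ℕ) {σ : ℝ} (hσ : 0 ≤ σ) :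
    gainWeight R d σ ≤ (1944 : ℝ) ^ (d 0 * d 1).primeFactors.card / ((d 0 : ℝ) * d 1) := by
  unfold gainWeight
  refine mul_le_of_le_one_right (by positivity) ?_
  refine Finset.prod_le_one (fun p hp => ?_) fun p _ => gainMin_le_one _ _ _
  exact gainMin_nonneg hR hσ (prime_of_mem_sievePrimes (Finset.mem_filter.mp hp).1).one_lt.le

/-- The pointwise majorant of `‖K_Y(τ) W_Y(τ)‖`:
`b_d(τ) G(τ)`, `b_d(τ) = C_K σ_τ^{216}/log² R · gainWeight(d; σ_τ)`. [cite: TaoTeravainen2021, §3.2 (proof of Lemma 3.4)] -/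
def kernelMajorant (R : ℝ) (h₁ h₂ : ℕ) (d : Fin 2 → ℕ) (τ : Fin 4 → ℝ) : ℝ :=
  kernelConst h₁ h₂ * tauSize τ ^ 216 / Real.log R ^ 2 * gainWeight R d (tauSize τ)

/-- `b_d ≥ 0`. [folklore] -/
theorem kernelMajorant_nonneg {R : ℝ} (hR : 1 < R) {h₁ h₂ : ℕ} (hne : h₁ ≠ h₂) (d : Fin 2 → ℕ)
    (τ : Fin 4 → ℝ) : 0 ≤ kernelMajorant R h₁ h₂ d τ := by
  unfold kernelMajorant
  have h1 := kernelConst_pos hne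
  have h2 := one_le_tauSize τ
  have h3 := gainWeight_nonneg hR d (by linarith : (0 : ℝ) ≤ tauSize τ)
  positivity

/-- `b_d` is continuous. [folklore] -/
theorem continuous_kernelMajorant (R : ℝ) (h₁ h₂ : ℕ) (d : Fin 2 → ℕ) :
    Continuous (kernelMajorant R h₁ h₂ d) := by
  unfold kernelMajorant
  exact ((continuous_const.mul (continuous_tauSize.pow 216)).div_const _).mul
    ((continuous_gainWeight R d).comp continuous_tauSize)

/-- `b_d G` is integrable on `ℝ⁴`. [folklore] -/
theorem integrable_kernelMajorant_mul {ψ : ℝ → ℝ} (hψ : IsSmoothCutoff ψ) {R : ℝ} (hR : 1 < R)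
    {h₁ h₂ : ℕ} (hne : h₁ ≠ h₂) (d : Fin 2 → ℕ) :
    Integrable fun τ : Fin 4 → ℝ => kernelMajorant R h₁ h₂ d τ * tauMajorant ψ τ := by
  have hmeas : AEStronglyMeasurable
      (fun τ : Fin 4 → ℝ => kernelMajorant R h₁ h₂ d τ * tauMajorant ψ τ) volume :=
    (continuous_kernelMajorant R h₁ h₂ d).aestronglyMeasurable.mul
      (measurable_tauMajorant hψ).aestronglyMeasurable
  set A : ℝ := kernelConst h₁ h₂ / Real.log R ^ 2 *
    ((1944 : ℝ) ^ (d 0 * d 1).primeFactors.card / ((d 0 : ℝ) * d 1)) with hA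
  have hA0 : 0 ≤ A := by
    have := kernelConst_pos hne
    positivity
  refine Integrable.mono' (((integrable_tauSize_pow_mul hψ 216).1).const_mul A) hmeas ?_
  filter_upwards with τ
  have hK0 := kernelMajorant_nonneg hR hne d τ
  have hG0 := tauMajorant_nonneg ψ τ
  rw [Real.norm_eq_abs, abs_of_nonneg (mul_nonneg hK0 hG0)]
  have hσ0 : (0 : ℝ) ≤ tauSize τ := by linarith [one_le_tauSize τ]
  have hgw := gainWeight_le hR d hσ0
  have hkC := (kernelConst_pos hne).le
  unfold kernelMajorant
  calc kernelConst h₁ h₂ * tauSize τ ^ 216 / Real.log R ^ 2 * gainWeight R d (tauSize τ) * tauMajorant ψ τ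
      ≤ kernelConst h₁ h₂ * tauSize τ ^ 216 / Real.log R ^ 2 *
          ((1944 : ℝ) ^ (d 0 * d 1).primeFactors.card / ((d 0 : ℝ) * d 1)) * tauMajorant ψ τ := by
        gcongr
    _ = A * (tauSize τ ^ 216 * tauMajorant ψ τ) := by rw [hA]; ring

/-- **The main term against the majorant**: for `h₁ ≠ h₂`, `R ≥ 3`, `d₀, d₁ ≥ 1`,
`|Σ(d)| ≤ 16 ∫_{ℝ⁴} b_d(τ) G(τ) dτ` (sixteen terms, `‖∫ K_Y W_Y‖ ≤ ∫ ‖K_Y‖ ‖W_Y‖` and the pointwise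
bounds `norm_sieveKernel_le`, `norm_padWeight_le`). [cite: TaoTeravainen2021, §3.2 (proof of Lemma 3.4)] -/
theorem abs_sieveMainSum_le_integral {ψ : ℝ → ℝ} (hψ : IsSmoothCutoff ψ) {h₁ h₂ : ℕ} (hne : h₁ ≠ h₂)
    {R : ℝ} (hR : 3 ≤ R) {d : Fin 2 → ℕ} (hd : ∀ j, d j ≠ 0) :
    |sieveMainSum ψ R h₁ h₂ d| ≤
      16 * ∫ τ : Fin 4 → ℝ, kernelMajorant R h₁ h₂ d τ * tauMajorant ψ τ := by
  have hR1 : 1 < R := by linarith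
  have hI := integrable_kernelMajorant_mul hψ hR1 hne d
  have hterm : ∀ Y : Finset (Fin 4),
      ‖(-1 : ℂ) ^ #Y * ∫ τ : Fin 4 → ℝ, sieveKernel R h₁ h₂ d Y τ * padWeight ψ Y τ‖ ≤
        ∫ τ : Fin 4 → ℝ, kernelMajorant R h₁ h₂ d τ * tauMajorant ψ τ := by
    intro Y
    rw [norm_mul, norm_pow, norm_neg, norm_one, one_pow, one_mul]
    refine (norm_integral_le_integral_norm _).trans ?_
    refine integral_mono_of_nonneg (Filter.Eventually.of_forall fun τ => norm_nonneg _) hI ?_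
    filter_upwards with τ
    rw [norm_mul]
    exact mul_le_mul (norm_sieveKernel_le hne hR hd Y τ) (norm_padWeight_le ψ Y τ) (norm_nonneg _)
      (kernelMajorant_nonneg hR1 hne d τ)
  have hcast : |sieveMainSum ψ R h₁ h₂ d| = ‖((sieveMainSum ψ R h₁ h₂ d : ℝ) : ℂ)‖ := by
    rw [Complex.norm_real, Real.norm_eq_abs]
  rw [hcast, sieveMainSum_eq_sum_integral hψ hR1 h₁ h₂ d]
  calc ‖∑ Y ∈ (Finset.univ : Finset (Fin 4)).powerset,
        (-1 : ℂ) ^ #Y * ∫ τ : Fin 4 → ℝ, sieveKernel R h₁ h₂ d Y τ * padWeight ψ Y τ‖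
      ≤ ∑ Y ∈ (Finset.univ : Finset (Fin 4)).powerset,
          ‖(-1 : ℂ) ^ #Y * ∫ τ : Fin 4 → ℝ, sieveKernel R h₁ h₂ d Y τ * padWeight ψ Y τ‖ :=
        norm_sum_le _ _
    _ ≤ ∑ _Y ∈ (Finset.univ : Finset (Fin 4)).powerset,
          ∫ τ : Fin 4 → ℝ, kernelMajorant R h₁ h₂ d τ * tauMajorant ψ τ :=
        Finset.sum_le_sum fun Y _ => hterm Y
    _ = 16 * ∫ τ : Fin 4 → ℝ, kernelMajorant R h₁ h₂ d τ * tauMajorant ψ τ := by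
        rw [Finset.sum_const, Finset.card_powerset, Finset.card_univ, Fintype.card_fin, nsmul_eq_mul]
        norm_num

/-! ### Lemma 3.4 in weighted form -/

/-- **Tao–Teräväinen 2022, Lemma 3.4 at `k = 2`, `ℓ' = 0`, in the weighted form consumed by (5.7)
and (5.8).** Let `h₁ ≠ h₂`, `ψ` a smooth cutoff with `|ψ| ≤ B`, `R ≥ 3`, and let `a_d ≥ 0` be weights
on a finite set `D` of pairs of moduli `d = (d₀, d₁)`, `d_j ≥ 1`. If for every `σ ≥ 1`
`∑_{d ∈ D} a_d · (1944^{ω(d₀d₁)}/(d₀d₁)) ∏_{p∣d₀d₁, p<R} min(σ log_R p, 1) ≤ M σ^N`, then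
`∑_{d ∈ D} a_d ∑_{n ≤ x} ν(n+h₁)1_{d₀∣n+h₁} ν(n+h₂)1_{d₁∣n+h₂}
   ≤ x · 16 C_K M J_{216+N}⁴ / log² R + (B⌈R⌉)⁴ ∑_{d ∈ D} a_d`.
This is the source's Lemma 3.4 (whose right-hand side is
`≪_A τ(d₁d₂)^{O(1)}/(d₁d₂ log² R) ∫₁^∞ ∏_{p∣d₁d₂} min(σ log_R p, 1) dσ/σ^A + R⁴/x` per pair `d`) with
the `σ`-integration against the rapidly decaying Fourier weights carried out once for the whole
weighted family, which is how the source applies it in the proofs of (5.7) and (5.8) ("Applying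
Lemma 3.4 … for any `A > 0` … choosing `A` large enough"). The gain `min(σ log_R p, 1)` at the primes
dividing the moduli, the size `1/(d₀d₁)`, the loss `log^{-2} R` and the error `O(R⁴)` are exactly as
printed; the divisor-type loss is `1944^{ω(d₀d₁)} ≤ τ(d₀d₁)^{11}`.
[cite: TaoTeravainen2021, Lemma 3.4 and its proof (§3.2)] -/
theorem sieveCorrelation_weighted_le {ψ : ℝ → ℝ} (hψ : IsSmoothCutoff ψ) {B : ℝ}
    (hB : ∀ u : ℝ, |ψ u| ≤ B) {h₁ h₂ : ℕ} (hne : h₁ ≠ h₂) {R : ℝ} (hR : 3 ≤ R)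
    (D : Finset (Fin 2 → ℕ)) (hD : ∀ d ∈ D, ∀ j, d j ≠ 0) (a : (Fin 2 → ℕ) → ℝ)
    (ha : ∀ d ∈ D, 0 ≤ a d) {M : ℝ} {N : ℕ}
    (hM : ∀ σ : ℝ, 1 ≤ σ → ∑ d ∈ D, a d * gainWeight R d σ ≤ M * σ ^ N) (x : ℕ) :
    ∑ d ∈ D, a d * sieveCorrelation ψ R h₁ h₂ d x ≤
      x * (16 * kernelConst h₁ h₂ * M * momentConst ψ (216 + N) ^ 4 / Real.log R ^ 2) +
        (B * ⌈R⌉₊) ^ 4 * ∑ d ∈ D, a d := by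
  have hR1 : 1 < R := by linarith
  have hlogR : 0 < Real.log R := Real.log_pos hR1
  have hkC := kernelConst_pos hne
  have hx0 : (0 : ℝ) ≤ x := Nat.cast_nonneg x
  -- `M ≥ 0`
  have hM0 : 0 ≤ M := by
    have h := hM 1 le_rfl
    rw [one_pow, mul_one] at h
    refine le_trans (Finset.sum_nonneg fun d hdD => mul_nonneg (ha d hdD) ?_) h
    exact gainWeight_nonneg hR1 d zero_le_one
  -- Step 1: `S(d) ≤ x |Σ(d)| + (B⌈R⌉)⁴`
  have hS : ∀ d ∈ D, sieveCorrelation ψ R h₁ h₂ d x ≤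
      x * |sieveMainSum ψ R h₁ h₂ d| + (B * ⌈R⌉₊) ^ 4 := by
    intro d hdD
    have h := abs_sieveCorrelation_sub_le hψ hB hR1 h₁ h₂ (d := d)
      (fun j => Nat.pos_of_ne_zero (hD d hdD j)) x
    have h2 := (abs_le.mp h).2
    have h3 : (x : ℝ) * sieveMainSum ψ R h₁ h₂ d ≤ x * |sieveMainSum ψ R h₁ h₂ d| :=
      mul_le_mul_of_nonneg_left (le_abs_self _) hx0
    linarith
  -- Step 2: `∑ a_d |Σ(d)| ≤ 16 ∫ (∑ a_d b_d) G ≤ 16 C_K M J⁴ / log² R`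
  have hint := fun d : Fin 2 → ℕ => integrable_kernelMajorant_mul hψ hR1 hne d
  have hIN := integrable_tauSize_pow_mul hψ (216 + N)
  have hSig : ∑ d ∈ D, a d * |sieveMainSum ψ R h₁ h₂ d| ≤
      16 * kernelConst h₁ h₂ * M * momentConst ψ (216 + N) ^ 4 / Real.log R ^ 2 := by
    calc ∑ d ∈ D, a d * |sieveMainSum ψ R h₁ h₂ d|
        ≤ ∑ d ∈ D, a d * (16 * ∫ τ : Fin 4 → ℝ, kernelMajorant R h₁ h₂ d τ * tauMajorant ψ τ) :=
          Finset.sum_le_sum fun d hdD =>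
            mul_le_mul_of_nonneg_left (abs_sieveMainSum_le_integral hψ hne hR (hD d hdD)) (ha d hdD)
      _ = 16 * ∑ d ∈ D, ∫ τ : Fin 4 → ℝ, a d * (kernelMajorant R h₁ h₂ d τ * tauMajorant ψ τ) := by
          rw [Finset.mul_sum]
          refine Finset.sum_congr rfl fun d _ => ?_
          rw [integral_const_mul]
          ring
      _ = 16 * ∫ τ : Fin 4 → ℝ, ∑ d ∈ D, a d * (kernelMajorant R h₁ h₂ d τ * tauMajorant ψ τ) := by
          rw [integral_finsetSum D fun d _ => (hint d).const_mul (a d)]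
      _ ≤ 16 * ∫ τ : Fin 4 → ℝ, (kernelConst h₁ h₂ * M / Real.log R ^ 2) *
            (tauSize τ ^ (216 + N) * tauMajorant ψ τ) := by
          refine mul_le_mul_of_nonneg_left ?_ (by norm_num)
          refine integral_mono (integrable_finsetSum D fun d _ => (hint d).const_mul (a d))
            (hIN.1.const_mul _) fun τ => ?_
          -- pointwise: `∑ a_d b_d G = (C σ^216/log² R)(∑ a_d gainWeight) G ≤ (C σ^216/log²R) M σ^N G`
          have hσ1 := one_le_tauSize τ
          have hG0 := tauMajorant_nonneg ψ τ
          have hsum := hM (tauSize τ) hσ1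
          simp only [kernelMajorant]
          have hrw : ∑ d ∈ D, a d * (kernelConst h₁ h₂ * tauSize τ ^ 216 / Real.log R ^ 2 *
              gainWeight R d (tauSize τ) * tauMajorant ψ τ) =
              (kernelConst h₁ h₂ * tauSize τ ^ 216 / Real.log R ^ 2 * tauMajorant ψ τ) *
                ∑ d ∈ D, a d * gainWeight R d (tauSize τ) := by
            rw [Finset.mul_sum]
            exact Finset.sum_congr rfl fun d _ => by ring
          rw [hrw]
          have hpos : 0 ≤ kernelConst h₁ h₂ * tauSize τ ^ 216 / Real.log R ^ 2 * tauMajorant ψ τ := by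
            have : 0 ≤ tauSize τ := by linarith
            positivity
          calc (kernelConst h₁ h₂ * tauSize τ ^ 216 / Real.log R ^ 2 * tauMajorant ψ τ) *
                ∑ d ∈ D, a d * gainWeight R d (tauSize τ)
              ≤ (kernelConst h₁ h₂ * tauSize τ ^ 216 / Real.log R ^ 2 * tauMajorant ψ τ) *
                  (M * tauSize τ ^ N) := mul_le_mul_of_nonneg_left hsum hpos
            _ = kernelConst h₁ h₂ * M / Real.log R ^ 2 * (tauSize τ ^ (216 + N) * tauMajorant ψ τ) := by
                rw [pow_add]
                ring
      _ = 16 * ((kernelConst h₁ h₂ * M / Real.log R ^ 2) *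
            ∫ τ : Fin 4 → ℝ, tauSize τ ^ (216 + N) * tauMajorant ψ τ) := by
          rw [integral_const_mul]
      _ ≤ 16 * ((kernelConst h₁ h₂ * M / Real.log R ^ 2) * momentConst ψ (216 + N) ^ 4) := by
          have h0 : 0 ≤ kernelConst h₁ h₂ * M / Real.log R ^ 2 := by positivity
          nlinarith [mul_le_mul_of_nonneg_left hIN.2 h0]
      _ = 16 * kernelConst h₁ h₂ * M * momentConst ψ (216 + N) ^ 4 / Real.log R ^ 2 := by ring
  -- Step 3: assemble
  calc ∑ d ∈ D, a d * sieveCorrelation ψ R h₁ h₂ d x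
      ≤ ∑ d ∈ D, a d * (x * |sieveMainSum ψ R h₁ h₂ d| + (B * ⌈R⌉₊) ^ 4) :=
        Finset.sum_le_sum fun d hdD => mul_le_mul_of_nonneg_left (hS d hdD) (ha d hdD)
    _ = x * ∑ d ∈ D, a d * |sieveMainSum ψ R h₁ h₂ d| + (B * ⌈R⌉₊) ^ 4 * ∑ d ∈ D, a d := by
        rw [Finset.mul_sum, Finset.mul_sum, ← Finset.sum_add_distrib]
        exact Finset.sum_congr rfl fun d _ => by ring
    _ ≤ x * (16 * kernelConst h₁ h₂ * M * momentConst ψ (216 + N) ^ 4 / Real.log R ^ 2) +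
          (B * ⌈R⌉₊) ^ 4 * ∑ d ∈ D, a d := by
        gcongr

end TaoTeravainen

end Literature.Barriers.Parity
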